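import Mathlib
import Literature.Geometry.DiscreteGeometry.CrystallographicGroups
import Summits.AtomisticToContinuum.Crystallization.Theorems.IsometryAtomsMinimisingLawsCohesiveGroupStructureAux1
import Summits.AtomisticToContinuum.Crystallization.Theorems.IsometryAtomsMinimisingLawsCohesiveGroupStructureAux3
import Summits.AtomisticToContinuum.Crystallization.Theorems.IsometryAtomsMinimisingLawsCohesiveGroupStructureAux4

/-!
# Discontinuous groups of isometries of `ℝ³`, part 6: the invariant axis

Helper file for stub `stub_groupStructure` (F) of line `purity_stacking` of the crux
`IsometryAtoms.MinimisingLawsCohesive` (stmt-AtomisticToContinuum-15777).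

**The screw case.** Let `Γ ≤ Isom(ℝ³)` be discontinuous, `e` a unit vector with `L(h) e = ±e`
for every `h ∈ Γ`, all translations of `Γ` along `e`, and INFINITELY many linear parts. Then
`Γ` leaves a line `c + ℝ e` invariant. Proof: part 4 gives `g₀ ∈ Γ` with linear part a small
nontrivial rotation `A` of determinant one; smallness forces `A e = e`, so `A` is SCREW-LIKE about
`e` (no fixed vectors orthogonal to `e`), and `g₀` has an axis `c + ℝ e` (solve `(1 - A) c = P(g₀ 0)`
in the plane `e^⊥`). A screw-like isometry has a unique axis; conjugation transports axes; so an
element commuting with `g₀` maps the axis to itself, and if `k_{j+1} = [g₀, k_j]` maps `c` to the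
axis then both `c` and `k_j c` lie on the axis of the screw-like `k_j g₀⁻¹ k_j⁻¹ = g₀⁻¹ k_{j+1}`,
whence `k_j` maps `c` to the axis: downward induction along the commutator sequence (part 4).
-/

noncomputable section

open scoped RealInnerProductSpace
open Literature.Geometry.DiscreteGeometry.Crystallographic Module

namespace Summit.AtomisticToContinuum.Crystallization.Theorems.IsometryAtomsMinimisingLawsCohesive.GroupStructure

/-! ## Screw-like linear isometries about a unit vector `e` -/

section Screw

variable {e : EuclideanSpace ℝ (Fin 3)}

/-- Membership in the line `ℝ e` for a vector with given `e`-component. -/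
theorem mem_span_singleton_of_sub_inner {x : EuclideanSpace ℝ (Fin 3)} (h : x - ⟪x, e⟫ • e = 0) :
    x ∈ Submodule.span ℝ ({e} : Set (EuclideanSpace ℝ (Fin 3))) :=
  Submodule.mem_span_singleton.2 ⟨⟪x, e⟫, by rw [sub_eq_zero] at h; exact h.symm⟩

/-- The `e`-orthogonal part `x - ⟨x,e⟩ e` is orthogonal to `e` (`‖e‖ = 1`). -/
theorem inner_sub_inner_smul (he : ‖e‖ = 1) (x : EuclideanSpace ℝ (Fin 3)) : ⟪x - ⟪x, e⟫ • e, e⟫ = 0 := by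
  rw [inner_sub_left, inner_smul_left, real_inner_self_eq_norm_sq, he]
  simp

/-- A vector of `ℝ e` orthogonal to `e` vanishes (`‖e‖ = 1`). -/
theorem eq_zero_of_mem_span_of_inner (he : ‖e‖ = 1) {w : EuclideanSpace ℝ (Fin 3)}
    (hw : w ∈ Submodule.span ℝ ({e} : Set (EuclideanSpace ℝ (Fin 3)))) (hwe : ⟪w, e⟫ = 0) : w = 0 := by
  obtain ⟨s, rfl⟩ := Submodule.mem_span_singleton.1 hw
  rw [inner_smul_left, real_inner_self_eq_norm_sq, he] at hwe
  simp only [RCLike.conj_to_real, one_pow, mul_one] at hwe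
  rw [hwe, zero_smul]

/-- An isometry fixing `e` preserves orthogonality to `e`. -/
theorem inner_map_eq_zero {B : EuclideanSpace ℝ (Fin 3) ≃ₗᵢ[ℝ] EuclideanSpace ℝ (Fin 3)} (hBe : B e = e)
    {w : EuclideanSpace ℝ (Fin 3)} (hw : ⟪w, e⟫ = 0) : ⟪B w, e⟫ = 0 := by
  conv_lhs => rw [← hBe]
  rw [B.inner_map_map, hw]

/-- **Uniqueness of the axis.** Let `f` be an isometry whose linear part `B` fixes `e` and has no
nonzero fixed vector orthogonal to `e` ("screw-like"). If `f p - p ∈ ℝ e` and `f q - q ∈ ℝ e`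
then `p - q ∈ ℝ e`. -/
theorem sub_mem_span_of_axis (he : ‖e‖ = 1) {f : EuclideanSpace ℝ (Fin 3) ≃ᵢ EuclideanSpace ℝ (Fin 3)}
    (hBe : f.toRealLinearIsometryEquiv e = e)
    (hBW : ∀ w, ⟪w, e⟫ = 0 → f.toRealLinearIsometryEquiv w = w → w = 0)
    {p q : EuclideanSpace ℝ (Fin 3)} (hp : f p - p ∈ Submodule.span ℝ ({e} : Set (EuclideanSpace ℝ (Fin 3))))
    (hq : f q - q ∈ Submodule.span ℝ ({e} : Set (EuclideanSpace ℝ (Fin 3)))) :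
    p - q ∈ Submodule.span ℝ ({e} : Set (EuclideanSpace ℝ (Fin 3))) := by
  set B := f.toRealLinearIsometryEquiv with hB
  set d := p - q with hd
  -- `B d - d ∈ ℝ e`
  have hBd : B d - d ∈ Submodule.span ℝ ({e} : Set (EuclideanSpace ℝ (Fin 3))) := by
    have h1 : B d = f p - f q := by rw [hd, hB, ← apply_sub_apply]
    have h2 : B d - d = (f p - p) - (f q - q) := by rw [h1, hd]; abel
    rw [h2]
    exact Submodule.sub_mem _ hp hq
  -- decompose `d = w + s e` with `w ⊥ e`
  set w := d - ⟪d, e⟫ • e with hw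
  have hwe : ⟪w, e⟫ = 0 := inner_sub_inner_smul he d
  have hBw : B w - w ∈ Submodule.span ℝ ({e} : Set (EuclideanSpace ℝ (Fin 3))) := by
    have : B w - w = (B d - d) - (⟪d, e⟫ • B e - ⟪d, e⟫ • e) := by
      rw [hw, map_sub, map_smul]; abel
    rw [this, hBe, sub_self, sub_zero]
    exact hBd
  have hBwe : ⟪B w - w, e⟫ = 0 := by
    rw [inner_sub_left, inner_map_eq_zero hBe hwe, hwe, sub_zero]
  have hBw0 : B w - w = 0 := eq_zero_of_mem_span_of_inner he hBw hBwe
  have hw0 : w = 0 := hBW w hwe (sub_eq_zero.1 hBw0)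
  exact mem_span_singleton_of_sub_inner (by rw [← hw, hw0])

/-- Screw-likeness passes to the inverse. -/
theorem screw_symm {B : EuclideanSpace ℝ (Fin 3) ≃ₗᵢ[ℝ] EuclideanSpace ℝ (Fin 3)} (hBe : B e = e)
    (hBW : ∀ w, ⟪w, e⟫ = 0 → B w = w → w = 0) :
    B.symm e = e ∧ ∀ w, ⟪w, e⟫ = 0 → B.symm w = w → w = 0 := by
  refine ⟨?_, fun w hw hfix => hBW w hw ?_⟩
  · conv_lhs => rw [← hBe]
    exact B.symm_apply_apply e
  · have := congrArg B hfix
    rw [B.apply_symm_apply] at this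
    exact this.symm

/-- Screw-likeness passes to conjugates by isometries mapping `e` to `±e`. -/
theorem screw_conj {B C : EuclideanSpace ℝ (Fin 3) ≃ₗᵢ[ℝ] EuclideanSpace ℝ (Fin 3)} (hBe : B e = e)
    (hBW : ∀ w, ⟪w, e⟫ = 0 → B w = w → w = 0) (hCe : C e = e ∨ C e = -e) :
    (C * B * C⁻¹) e = e ∧ ∀ w, ⟪w, e⟫ = 0 → (C * B * C⁻¹) w = w → w = 0 := by
  -- the inverse of `C` maps `e` to `±e` with the same sign
  have hCinv : (C e = e ∧ C.symm e = e) ∨ (C e = -e ∧ C.symm e = -e) := by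
    rcases hCe with h | h
    · left
      refine ⟨h, ?_⟩
      conv_lhs => rw [← h]
      exact C.symm_apply_apply e
    · right
      refine ⟨h, ?_⟩
      have h2 : C (-e) = e := by rw [map_neg, h, neg_neg]
      conv_lhs => rw [← h2]
      exact C.symm_apply_apply (-e)
  refine ⟨?_, fun w hw hfix => ?_⟩
  · change C (B (C.symm e)) = e
    rcases hCinv with ⟨h, hs⟩ | ⟨h, hs⟩
    · rw [hs, hBe, h]
    · rw [hs, map_neg, hBe, map_neg, h, neg_neg]
  · -- `C B C⁻¹ w = w` ⇒ `B (C⁻¹ w) = C⁻¹ w` with `C⁻¹ w ⊥ e`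
    have h1 : B (C.symm w) = C.symm w := by
      have := congrArg C.symm hfix
      change C.symm (C (B (C.symm w))) = C.symm w at this
      rwa [C.symm_apply_apply] at this
    have h2 : ⟪C.symm w, e⟫ = 0 := by
      have h3 : ⟪C.symm w, C.symm e⟫ = ⟪w, e⟫ := C.symm.inner_map_map w e
      rcases hCinv with ⟨-, hs⟩ | ⟨-, hs⟩
      · rw [hs, hw] at h3; exact h3
      · rw [hs, inner_neg_right, hw, neg_eq_zero] at h3; exact h3
    have h3 := hBW _ h2 h1
    have : w = C (C.symm w) := (C.apply_symm_apply w).symm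
    rw [this, h3, map_zero]

/-- A nontrivial determinant-one isometry fixing `e` is screw-like about `e`. -/
theorem screw_of_det_one (he : ‖e‖ = 1) {A : EuclideanSpace ℝ (Fin 3) ≃ₗᵢ[ℝ] EuclideanSpace ℝ (Fin 3)}
    (hdet : LinearMap.det (A.toLinearEquiv : EuclideanSpace ℝ (Fin 3) →ₗ[ℝ] EuclideanSpace ℝ (Fin 3)) = 1)
    (hA1 : A ≠ 1) (hAe : A e = e) : ∀ w, ⟪w, e⟫ = 0 → A w = w → w = 0 := by
  intro w hw hfix
  have he0 : e ≠ 0 := by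
    intro h; rw [h, norm_zero] at he; exact zero_ne_one he
  obtain ⟨c, hc⟩ := fixed_mem_span_of_ne_one hdet hA1 he0 hAe hfix
  exact eq_zero_of_mem_span_of_inner he (Submodule.mem_span_singleton.2 ⟨c, hc.symm⟩) hw

/-- A small isometry mapping `e` to `±e` fixes `e`. -/
theorem apply_eq_of_small_of_or (he : ‖e‖ = 1) {A : EuclideanSpace ℝ (Fin 3) ≃ₗᵢ[ℝ] EuclideanSpace ℝ (Fin 3)}
    (hsmall : ‖(A.toContinuousLinearEquiv : EuclideanSpace ℝ (Fin 3) →L[ℝ] EuclideanSpace ℝ (Fin 3)) - 1‖ ≤ 1 / 10)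
    (hAe : A e = e ∨ A e = -e) : A e = e := by
  refine hAe.resolve_right fun h => ?_
  have h1 := norm_sub_le_dev A e
  rw [h, he, mul_one, show -e - e = (-2 : ℝ) • e by rw [neg_smul, two_smul]; abel, norm_smul, he] at h1
  norm_num at h1
  linarith

end Screw

/-! ## Existence of an axis -/

/-- **Existence of an axis.** If the linear part `A` of `g` is screw-like about the unit vector
`e`, some point `c` is moved by `g` along `e`: `g c - c ∈ ℝ e` (solve `c - A c = P (g 0)` in the
plane `e^⊥`, where `1 - A` is injective hence onto). -/
theorem exists_axis_point {e : EuclideanSpace ℝ (Fin 3)} (he : ‖e‖ = 1) {g : EuclideanSpace ℝ (Fin 3) ≃ᵢ EuclideanSpace ℝ (Fin 3)}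
    (hAe : g.toRealLinearIsometryEquiv e = e)
    (hAW : ∀ w, ⟪w, e⟫ = 0 → g.toRealLinearIsometryEquiv w = w → w = 0) :
    ∃ c : EuclideanSpace ℝ (Fin 3), g c - c ∈ Submodule.span ℝ ({e} : Set (EuclideanSpace ℝ (Fin 3))) := by
  set A := g.toRealLinearIsometryEquiv with hA
  set W : Submodule ℝ (EuclideanSpace ℝ (Fin 3)) := (Submodule.span ℝ ({e} : Set (EuclideanSpace ℝ (Fin 3))))ᗮ with hW
  have hWmem : ∀ x, x ∈ W ↔ ⟪x, e⟫ = 0 := fun x => by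
    rw [hW, Submodule.mem_orthogonal_singleton_iff_inner_left]
  -- the linear map `1 - A` restricted to `W`
  set f : EuclideanSpace ℝ (Fin 3) →ₗ[ℝ] EuclideanSpace ℝ (Fin 3) :=
    LinearMap.id - (A.toLinearEquiv : EuclideanSpace ℝ (Fin 3) →ₗ[ℝ] EuclideanSpace ℝ (Fin 3)) with hf
  have hfapp : ∀ x, f x = x - A x := fun x => rfl
  have hfW : ∀ x ∈ W, f x ∈ W := by
    intro x hx
    rw [hWmem] at hx ⊢
    rw [hfapp, inner_sub_left, hx, inner_map_eq_zero hAe hx, sub_zero]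
  set D : W →ₗ[ℝ] W := f.restrict hfW with hD
  have hDinj : Function.Injective D := by
    rw [← LinearMap.ker_eq_bot, Submodule.eq_bot_iff]
    intro w hw
    rw [LinearMap.mem_ker] at hw
    have hw' : f (w : EuclideanSpace ℝ (Fin 3)) = 0 := by
      have := congrArg Subtype.val hw
      simpa [hD, LinearMap.restrict_apply] using this
    rw [hfapp, sub_eq_zero] at hw'
    have := hAW w ((hWmem w).1 w.2) hw'.symm
    exact Subtype.ext this
  have hDsurj : Function.Surjective D := LinearMap.surjective_of_injective hDinj
  -- target: the `e`-orthogonal part of `g 0`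
  set t : EuclideanSpace ℝ (Fin 3) := g 0 - ⟪g 0, e⟫ • e with ht
  have htW : t ∈ W := (hWmem t).2 (inner_sub_inner_smul he (g 0))
  obtain ⟨c, hc⟩ := hDsurj ⟨t, htW⟩
  refine ⟨c, ?_⟩
  have hc' : (c : EuclideanSpace ℝ (Fin 3)) - A c = t := by
    have := congrArg Subtype.val hc
    simpa [hD, LinearMap.restrict_apply, hfapp] using this
  -- `g c - c = A c + g 0 - c = g 0 - t = ⟨g 0, e⟩ e`
  rw [apply_eq_lin_add g c, ← hA]
  have : A c + g 0 - c = ⟪g 0, e⟫ • e := by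
    have h1 : A c = c - t := by rw [← hc']; abel
    rw [h1, ht]; abel
  rw [this]
  exact Submodule.smul_mem _ _ (Submodule.mem_span_singleton_self e)

/-! ## The invariant axis of the screw case -/

/-- **The invariant axis (screw case).** `Γ` discontinuous; `e` a unit vector with `L(h) e = ±e`
for all `h ∈ Γ`; translations of `Γ` along `e`; infinitely many linear parts. Then there is `c`
with `h c - c ∈ ℝ e` for every `h ∈ Γ`. -/
theorem exists_axis_of_infinite {Γ : Subgroup (EuclideanSpace ℝ (Fin 3) ≃ᵢ EuclideanSpace ℝ (Fin 3))}
    (hΓ : IsDiscontinuous Γ) {e : EuclideanSpace ℝ (Fin 3)} (he : ‖e‖ = 1)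
    (hax : ∀ h ∈ Γ, h.toRealLinearIsometryEquiv e = e ∨ h.toRealLinearIsometryEquiv e = -e)
    (hT : ∀ v ∈ translationVectors Γ, ∃ s : ℝ, v = s • e)
    (hinf : ((fun g : EuclideanSpace ℝ (Fin 3) ≃ᵢ EuclideanSpace ℝ (Fin 3) => g.toRealLinearIsometryEquiv) ''
      (Γ : Set (EuclideanSpace ℝ (Fin 3) ≃ᵢ EuclideanSpace ℝ (Fin 3)))).Infinite) :
    ∃ c : EuclideanSpace ℝ (Fin 3), ∀ h ∈ Γ, h c - c ∈ Submodule.span ℝ ({e} : Set (EuclideanSpace ℝ (Fin 3))) := by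
  -- a small nontrivial rotation `g₀ ∈ Γ`; it fixes `e` and is screw-like about `e`
  obtain ⟨g₀, hg₀, hA1, hdet, hsmall⟩ := exists_small_rotation hinf (by norm_num : (0 : ℝ) < 1 / 10) (by norm_num)
  set A := g₀.toRealLinearIsometryEquiv with hA
  have hAe : A e = e := apply_eq_of_small_of_or he hsmall.le (hax g₀ hg₀)
  have hAW : ∀ w, ⟪w, e⟫ = 0 → A w = w → w = 0 := screw_of_det_one he hdet hA1 hAe
  -- its axis point `c`
  obtain ⟨c, hc⟩ := exists_axis_point he hAe hAW
  refine ⟨c, fun h hh => ?_⟩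
  -- commutator sequence of `h`
  let k : ℕ → (EuclideanSpace ℝ (Fin 3) ≃ᵢ EuclideanSpace ℝ (Fin 3)) :=
    fun j => Nat.rec h (fun _ kj => g₀ * kj * g₀⁻¹ * kj⁻¹) j
  have hk0 : k 0 = h := rfl
  have hks : ∀ j, k (j + 1) = g₀ * k j * g₀⁻¹ * (k j)⁻¹ := fun j => rfl
  have hfixT : ∀ v ∈ translationVectors Γ, A v = v := by
    intro v hv; obtain ⟨s, rfl⟩ := hT v hv; rw [map_smul, hAe]
  obtain ⟨J, hJ⟩ := exists_commSeq_eq_one hΓ hg₀ hh hsmall.le hfixT hk0 hks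
  have hkΓ : ∀ j, k j ∈ Γ := commSeq_mem hg₀ hh hk0 hks
  -- `g₀⁻¹ c - c ∈ ℝ e` as well
  obtain ⟨hAe', hAW'⟩ := screw_symm hAe hAW
  have hc_inv : g₀⁻¹ c - c ∈ Submodule.span ℝ ({e} : Set (EuclideanSpace ℝ (Fin 3))) := by
    have h1 : g₀⁻¹ c - c = -(g₀⁻¹.toRealLinearIsometryEquiv (g₀ c - c)) := by
      rw [← apply_sub_apply]
      change g₀.symm c - c = -(g₀.symm (g₀ c) - g₀.symm c)
      rw [g₀.symm_apply_apply]; abel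
    rw [h1, lin_inv]
    refine Submodule.neg_mem _ ?_
    obtain ⟨s, hs⟩ := Submodule.mem_span_singleton.1 hc
    rw [← hs, map_smul]
    change s • A.symm e ∈ _
    rw [hAe']
    exact Submodule.smul_mem _ _ (Submodule.mem_span_singleton_self e)
  -- downward induction with `Q f := f ∈ Γ → f c - c ∈ ℝ e`
  have hQ := commSeq_downward (k := k) (g := g₀)
    (Q := fun f => f ∈ Γ → f c - c ∈ Submodule.span ℝ ({e} : Set (EuclideanSpace ℝ (Fin 3)))) hks hJ
    (fun f hf hfΓ => by
      -- `f` commutes with `g₀`: `g₀ (f c) - f c = L(f) (g₀ c - c) ∈ ℝ e`, then uniqueness of the axis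
      have h1 : g₀ (f c) - f c ∈ Submodule.span ℝ ({e} : Set (EuclideanSpace ℝ (Fin 3))) := by
        have h2 : g₀ (f c) = f (g₀ c) := by
          have := congrArg (fun m : EuclideanSpace ℝ (Fin 3) ≃ᵢ EuclideanSpace ℝ (Fin 3) => m c) hf
          simpa [IsometryEquiv.coe_mul] using this
        rw [h2, apply_sub_apply]
        obtain ⟨s, hs⟩ := Submodule.mem_span_singleton.1 hc
        rw [← hs, map_smul]
        rcases hax f hfΓ with h3 | h3 <;> rw [h3]
        · exact Submodule.smul_mem _ _ (Submodule.mem_span_singleton_self e)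
        · exact Submodule.smul_mem _ _ (Submodule.neg_mem _ (Submodule.mem_span_singleton_self e))
      have := sub_mem_span_of_axis he hAe hAW h1 hc
      exact this)
    (fun j hj hjΓ => by
      -- `C := k_j g₀⁻¹ k_j⁻¹ = g₀⁻¹ k_{j+1}` is screw-like; `c` and `k_j c` lie on its axis
      have hj' := hj (hkΓ (j + 1))
      set f := k j with hf
      have hfΓ : f ∈ Γ := hkΓ j
      set C := f * g₀⁻¹ * f⁻¹ with hC
      have hCeq : C = g₀⁻¹ * k (j + 1) := by
        rw [hks, ← hf, hC]; group
      -- screw-likeness of `C`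
      have hCscrew := screw_conj (B := A.symm) (C := f.toRealLinearIsometryEquiv) hAe' hAW' (hax f hfΓ)
      have hClin : C.toRealLinearIsometryEquiv = f.toRealLinearIsometryEquiv * A.symm * (f.toRealLinearIsometryEquiv)⁻¹ := by
        rw [hC, lin_mul, lin_mul, lin_inv, lin_inv, hA]; rfl
      rw [← hClin] at hCscrew
      -- `c` on the axis of `C`
      have h1 : C c - c ∈ Submodule.span ℝ ({e} : Set (EuclideanSpace ℝ (Fin 3))) := by
        rw [hCeq, IsometryEquiv.coe_mul, Function.comp_apply]
        obtain ⟨s, hs⟩ := Submodule.mem_span_singleton.1 hj'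
        have h2' : k (j + 1) c = s • e + c := by
          have := hs; rw [eq_sub_iff_add_eq] at this; exact this.symm
        rw [h2', show g₀⁻¹ (s • e + c) = g₀⁻¹.toRealLinearIsometryEquiv (s • e) + g₀⁻¹ c by
          rw [apply_eq_lin_add g₀⁻¹ (s • e + c), map_add, apply_eq_lin_add g₀⁻¹ c]; abel]
        rw [lin_inv, map_smul, ← hA]
        change s • A.symm e + g₀⁻¹ c - c ∈ _
        rw [hAe', add_sub_assoc]
        exact Submodule.add_mem _ (Submodule.smul_mem _ _ (Submodule.mem_span_singleton_self e)) hc_inv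
      -- `f c` on the axis of `C`: `C (f c) - f c = L(f) (g₀⁻¹ c - c)`
      have h3 : C (f c) - f c ∈ Submodule.span ℝ ({e} : Set (EuclideanSpace ℝ (Fin 3))) := by
        have h4 : C (f c) = f (g₀⁻¹ c) := by
          rw [hC, IsometryEquiv.coe_mul, IsometryEquiv.coe_mul, Function.comp_apply, Function.comp_apply]
          change f (g₀⁻¹ (f.symm (f c))) = _
          rw [f.symm_apply_apply]
        rw [h4, apply_sub_apply]
        obtain ⟨s, hs⟩ := Submodule.mem_span_singleton.1 hc_inv
        rw [← hs, map_smul]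
        rcases hax f hfΓ with h5 | h5 <;> rw [h5]
        · exact Submodule.smul_mem _ _ (Submodule.mem_span_singleton_self e)
        · exact Submodule.smul_mem _ _ (Submodule.neg_mem _ (Submodule.mem_span_singleton_self e))
      have := sub_mem_span_of_axis he hCscrew.1 hCscrew.2 h3 h1
      exact this)
  exact hQ hh

/-- From "every `h ∈ Γ` moves `c` along `e`" (and `L(h) e = ±e`) to the invariance of the line
`c + ℝ e` as an affine subspace. -/
theorem image_line_eq {Γ : Subgroup (EuclideanSpace ℝ (Fin 3) ≃ᵢ EuclideanSpace ℝ (Fin 3))}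
    {e c : EuclideanSpace ℝ (Fin 3)}
    (hax : ∀ h ∈ Γ, h.toRealLinearIsometryEquiv e = e ∨ h.toRealLinearIsometryEquiv e = -e)
    (hc : ∀ h ∈ Γ, h c - c ∈ Submodule.span ℝ ({e} : Set (EuclideanSpace ℝ (Fin 3))))
    {h : EuclideanSpace ℝ (Fin 3) ≃ᵢ EuclideanSpace ℝ (Fin 3)} (hh : h ∈ Γ) :
    h '' (AffineSubspace.mk' c (Submodule.span ℝ ({e} : Set (EuclideanSpace ℝ (Fin 3)))) : Set (EuclideanSpace ℝ (Fin 3))) =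
      AffineSubspace.mk' c (Submodule.span ℝ ({e} : Set (EuclideanSpace ℝ (Fin 3)))) := by
  have hinto : ∀ h ∈ Γ, h '' (AffineSubspace.mk' c (Submodule.span ℝ ({e} : Set (EuclideanSpace ℝ (Fin 3)))) :
      Set (EuclideanSpace ℝ (Fin 3))) ⊆ AffineSubspace.mk' c (Submodule.span ℝ ({e} : Set (EuclideanSpace ℝ (Fin 3)))) := by
    rintro h hh _ ⟨x, hx, rfl⟩
    rw [SetLike.mem_coe, AffineSubspace.mem_mk', vsub_eq_sub] at hx ⊢
    -- `h x - c = L(h) (x - c) + (h c - c)`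
    have : h x - c = h.toRealLinearIsometryEquiv (x - c) + (h c - c) := by
      rw [← apply_sub_apply]; abel
    rw [this]
    refine Submodule.add_mem _ ?_ (hc h hh)
    obtain ⟨s, hs⟩ := Submodule.mem_span_singleton.1 hx
    rw [← hs, map_smul]
    rcases hax h hh with h1 | h1 <;> rw [h1]
    · exact Submodule.smul_mem _ _ (Submodule.mem_span_singleton_self e)
    · exact Submodule.smul_mem _ _ (Submodule.neg_mem _ (Submodule.mem_span_singleton_self e))
  refine Set.Subset.antisymm (hinto h hh) fun x hx => ?_
  exact ⟨h⁻¹ x, hinto h⁻¹ (Γ.inv_mem hh) ⟨x, hx, rfl⟩, h.apply_symm_apply x⟩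

/-- Anchor (registered sub-goal of `stub_groupStructure`): **the invariant axis of the screw
case** — discontinuous `Γ`, all linear parts preserve `±e`, translations along `e`, infinitely many
linear parts ⇒ an invariant line `c + ℝ e`. -/
theorem groupStructure_invariantLine_of_infinite_linParts : ∀ Γ : Subgroup (EuclideanSpace ℝ (Fin 3) ≃ᵢ EuclideanSpace ℝ (Fin 3)), Literature.Geometry.DiscreteGeometry.Crystallographic.IsDiscontinuous Γ → ∀ e : EuclideanSpace ℝ (Fin 3), ‖e‖ = 1 → (∀ h ∈ Γ, h.toRealLinearIsometryEquiv e = e ∨ h.toRealLinearIsometryEquiv e = -e) → (∀ v ∈ Literature.Geometry.DiscreteGeometry.Crystallographic.translationVectors Γ, ∃ s : ℝ, v = s • e) → ((fun g : EuclideanSpace ℝ (Fin 3) ≃ᵢ EuclideanSpace ℝ (Fin 3) => g.toRealLinearIsometryEquiv) '' (Γ : Set (EuclideanSpace ℝ (Fin 3) ≃ᵢ EuclideanSpace ℝ (Fin 3)))).Infinite → ∃ c : EuclideanSpace ℝ (Fin 3), ∀ h ∈ Γ, h '' (AffineSubspace.mk' c (Submodule.span ℝ {e}) : Set (EuclideanSpace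 ℝ (Fin 3))) = AffineSubspace.mk' c (Submodule.span ℝ {e}) := by
  intro Γ hΓ e he hax hT hinf
  obtain ⟨c, hc⟩ := exists_axis_of_infinite hΓ he hax hT hinf
  exact ⟨c, fun h hh => image_line_eq hax hc hh⟩

end Summit.AtomisticToContinuum.Crystallization.Theorems.IsometryAtomsMinimisingLawsCohesive.GroupStructure

end
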